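import Summits.QuantumFields.YangMills.Theorems.PencilRigidityNPointIsotropyMopupHelpers

/-!
# `PencilRigidity.NPointIsotropy`, line `complex-rotation-bandlimit`: the mop-up stub `stub_mopup`

Stub `stub_mopup` of crux `stmt-QuantumFields-11686` (`Summit.QuantumFields.YangMills.Theses.PencilRigidity.NPointIsotropy`),
line `complex-rotation-bandlimit`, proved over the tree as it is, in two strengths:
* `planarInvariant_of_regular` — the `L¹` form (= the generation-2 registered `stub_mopup : ∀ S₁, NPointRegular S₁ →
  GenericPlanarInvariant S₁ → PlanarInvariant S₁` of `Cruxes/NPointIsotropy/Lines/complex-rotation-bandlimit.lean`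
  with its line-local predicates unfolded verbatim): regularity = every `𝔖ₙ|⁰𝒮ₙ` is integration against a FUNCTION;
* `stub_mopup` — the text registered with the lead's skeleton r1 (regularity with continuity of `Wₙ` off the
  coincidence locus, the disprover's `NPointIsotropyRegularModelBlind` clause), a one-line corollary.

Informal statement (`L¹` form). Let `S₁` be a one-species Schwinger family on `ℝ⁴` such that
(1) for every `n` there is a function `Wₙ` with `Wₙ·F` integrable and `𝔖ₙ(F) = ∫ Wₙ F` for all `F ∈ ⁰𝒮ₙ`
(off-diagonal test functions), and (2) `𝔖ₙ(R_θ · F) = 𝔖ₙ(F)` for every angle `θ` (`R_θ = planeRot 0 θ`, the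
rotation of the `(x₀,x₁)`-plane) and every off-diagonal compactly supported `F` whose support is planar-generic
(at every angle `φ` the rotated support has pairwise distinct `x₀`-coordinates or pairwise distinct
`x₁`-coordinates). Then `𝔖ₙ(R · F) = 𝔖ₙ(F)` for every determinant-one linear isometry `R` of `ℝ⁴` fixing
`e₂, e₃`, every `n` and every `F ∈ ⁰𝒮ₙ` (`PlanarInvariant S₁`).

Proof. (a) `R = planeRot 0 φ` for some `φ` (`Mopup.exists_eq_planeRot`, helpers file). (b) The algebraic generic
set `G = {x | ⟨π(xᵢ-xⱼ), π(x_k-x_l)⟩ ≠ 0 ∀ i ≠ j, k ≠ l}` is open, CONULL (its complement is a finite union of the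
null quadrics `Mopup.volume_pairing_eq_zero` of the helpers file), avoids the coincidence locus
(`|π(xᵢ-xⱼ)|² ≠ 0`) and is planar-generic at every angle: if at the angle `φ` a pair of rotated `x₀`-coordinates
and a pair of rotated `x₁`-coordinates both coincide, then `⟨R_φ π d_{ij}, e₀⟩ = 0 = ⟨R_φ π d_{kl}, e₁⟩`, whence
`⟨π d_{ij}, π d_{kl}⟩ = 0` (`Mopup.exists_generic_set`). (c) `Mopup.apply_linActMulti_eq_of_generic`: with
`L = R_φ`, `𝔖ₙ(L·F') = ∫ Wₙ (L·F') = ∫ (Wₙ ∘ L) F'` for off-diagonal `F'` (Lebesgue measure on `(ℝ⁴)ⁿ` is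
`L`-invariant), so the defect `D = Wₙ ∘ L - Wₙ` has `D·F'` integrable with `∫ D F' = 𝔖ₙ(L·F') - 𝔖ₙ(F')`, which
vanishes for `F'` compactly supported in `G` by (2). For `F ∈ ⁰𝒮ₙ` take the truncations `χ_k F` with a smooth
compactly supported exhaustion `χ_k → 1_G` of `G` (`Mopup.exists_smooth_exhaustion`: a smooth function with support
exactly `G`, `IsOpen.exists_contDiff_support_eq`, cut off by `Real.smoothTransition` and a large bump): they are
Schwartz (`HasCompactSupport.toSchwartzMap`), supported in `G`, hence off-diagonal and planar-generic, so
`∫ D χ_k F = 0`; dominated convergence (`|χ_k| ≤ 1`, bound `|D F|`) gives `∫ 1_G D F = 0`, and `1_G D F = D F`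
a.e. because `Gᶜ` is null. Hence `𝔖ₙ(L·F) = 𝔖ₙ(F)`.

This is exactly the step that is FALSE without the regularity clause (landed `Negative/PlanarGenericJunk.lean`:
the junk functional charges a null set); with it, it is an a.e. statement. No density or continuity across the
exceptional set is used. References: folklore; K. Osterwalder, R. Schrader, Comm. Math. Phys. 31 (1973) §4.2 for
the change-of-variables pattern (tree, `OSLorentzInvariance.apply_euclideanPoint_planeRot_eq`).

Design notes. No `def`; helpers in the sub-namespace `Mopup`. The file does not remove Mathlib's `SimplexCategory`
`Fintype (Fin (x.len + 1))` instance: the statements elaborated here are accepted verbatim (`exact stub_mopup`,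
checked) in a context where that instance is removed, as in the skeleton files.
-/

noncomputable section

namespace Summit.QuantumFields.YangMills.Theorems.NPointIsotropy.ComplexRotationBandlimit

open scoped BigOperators SchwartzMap InnerProductSpace Topology ENNReal
open MeasureTheory Filter
open Literature.MathematicalPhysics.QuantumLattice Literature.MathematicalPhysics.AQFT
  Literature.MathematicalPhysics.QuantumFieldTheory
open Summit.QuantumFields.YangMills.Theorems.NPointIsotropy.Negative (E4)
open Summit.QuantumFields.YangMills.Theorems.CurvatureBoostCovariance.Negative
  (PlanarInvariant isOffDiagonal_linActMulti)

namespace Mopup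

variable {n : ℕ}

/-! ## The algebraic generic set (open, conull, off the coincidence locus, planar-generic) -/

/-- Coordinates `0` and `1` of the plane rotation `planeRot 0 φ` on `ℝ⁴`. [folklore] -/
theorem planeRot_zero_one (φ : ℝ) (y : E4) :
    (planeRot (d := 3) 0 φ y) 0 = Real.cos φ * y 0 + Real.sin φ * y 1 ∧
      (planeRot (d := 3) 0 φ y) 1 = -Real.sin φ * y 0 + Real.cos φ * y 1 := by
  refine ⟨by simp [planeRot_apply], ?_⟩
  rw [planeRot_apply]
  simp [Fin.succ_zero_eq_one]

/-- **The algebraic generic set.** There is an open CONULL set `G` of `n`-point configurations, avoiding the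
coincidence locus, on which for EVERY angle `φ` the rotated configuration has pairwise distinct `x₀`-coordinates or
pairwise distinct `x₁`-coordinates: `G = {x | ⟨π(xᵢ-xⱼ), π(x_k-x_l)⟩ ≠ 0 for all i ≠ j, k ≠ l}` (all planar
differences non-zero and pairwise non-orthogonal; its complement is a finite union of null quadrics,
`volume_pairing_eq_zero`). [folklore] -/
theorem exists_generic_set (n : ℕ) :
    ∃ G : Set (Fin n → E4), IsOpen G ∧ volume Gᶜ = 0 ∧ G ⊆ (coincidenceLocus n E4)ᶜ ∧
      ∀ x ∈ G, ∀ φ : ℝ,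
        (∀ i j : Fin n, i ≠ j → (planeRot (d := 3) 0 φ (x i)) 0 ≠ (planeRot (d := 3) 0 φ (x j)) 0) ∨
        (∀ i j : Fin n, i ≠ j → (planeRot (d := 3) 0 φ (x i)) 1 ≠ (planeRot (d := 3) 0 φ (x j)) 1) := by
  -- the pairing and the generic set
  set P : Fin n → Fin n → Fin n → Fin n → (Fin n → E4) → ℝ := fun i j k l x =>
    (x i 0 - x j 0) * (x k 0 - x l 0) + (x i 1 - x j 1) * (x k 1 - x l 1) with hP
  set G : Set (Fin n → E4) := ⋂ i, ⋂ j, ⋂ k, ⋂ l, {x | i ≠ j → k ≠ l → P i j k l x ≠ 0} with hG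
  have hmem : ∀ x, x ∈ G ↔ ∀ i j k l : Fin n, i ≠ j → k ≠ l → P i j k l x ≠ 0 := fun x => by
    simp only [hG, Set.mem_iInter, Set.mem_setOf_eq]
  have hPc : ∀ i j k l, Continuous (P i j k l) := fun i j k l => continuous_pairing i j k l
  -- each defining condition cuts out an open conull set
  have hfac : ∀ i j k l : Fin n, IsOpen {x : Fin n → E4 | i ≠ j → k ≠ l → P i j k l x ≠ 0} ∧
      volume {x : Fin n → E4 | i ≠ j → k ≠ l → P i j k l x ≠ 0}ᶜ = 0 := by
    intro i j k l
    by_cases hij : i = j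
    · simp [hij]
    by_cases hkl : k = l
    · simp [hkl]
    have hset : {x : Fin n → E4 | i ≠ j → k ≠ l → P i j k l x ≠ 0} = {x | P i j k l x ≠ 0} := by
      ext x; simp [hij, hkl]
    rw [hset]
    refine ⟨isOpen_ne_fun (hPc i j k l) continuous_const, ?_⟩
    have hc : {x : Fin n → E4 | P i j k l x ≠ 0}ᶜ = {x | P i j k l x = 0} := by
      ext x; simp
    rw [hc]
    exact volume_pairing_eq_zero i j k l hij hkl
  refine ⟨G, ?_, ?_, ?_, ?_⟩
  · exact isOpen_iInter_of_finite fun i => isOpen_iInter_of_finite fun j =>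
      isOpen_iInter_of_finite fun k => isOpen_iInter_of_finite fun l => (hfac i j k l).1
  · simp only [hG, Set.compl_iInter]
    exact measure_iUnion_null fun i => measure_iUnion_null fun j =>
      measure_iUnion_null fun k => measure_iUnion_null fun l => (hfac i j k l).2
  · -- off the coincidence locus: `P i j i j x = |π(xᵢ - xⱼ)|² ≠ 0`
    rintro x hx ⟨i, j, hij, hxij⟩
    have h := (hmem x).1 hx i j i j hij hij
    simp [hP, hxij] at h
  · -- genericity at every angle
    intro x hx φ
    by_contra hcon
    simp only [not_or, not_forall, not_not, exists_prop] at hcon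
    obtain ⟨⟨i, j, hij, h0⟩, ⟨k, l, hkl, h1⟩⟩ := hcon
    rw [(planeRot_zero_one φ (x i)).1, (planeRot_zero_one φ (x j)).1] at h0
    rw [(planeRot_zero_one φ (x k)).2, (planeRot_zero_one φ (x l)).2] at h1
    have hcs := Real.cos_sq_add_sin_sq φ
    refine (hmem x).1 hx i j k l hij hkl ?_
    simp only [hP]
    linear_combination (Real.cos φ * (x k 0 - x l 0) + Real.sin φ * (x k 1 - x l 1)) * h0 +
      (-Real.sin φ * (x i 0 - x j 0) + Real.cos φ * (x i 1 - x j 1)) * h1 -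
      ((x i 0 - x j 0) * (x k 0 - x l 0) + (x i 1 - x j 1) * (x k 1 - x l 1)) * hcs

/-! ## The a.e. mop-up: truncation, dominated convergence -/

/-- **Smooth compactly supported exhaustion of an open set** of a finite-dimensional real normed space: smooth
`χ_k : X → [0,1]` with compact support inside `G`, eventually `1` at every point of `G` and `0` off `G`
(from a smooth function with support exactly `G`, `IsOpen.exists_contDiff_support_eq`, cut off by
`Real.smoothTransition` and a bump of large radius). [folklore] -/
theorem exists_smooth_exhaustion {X : Type*} [NormedAddCommGroup X] [NormedSpace ℝ X]
    [FiniteDimensional ℝ X] {G : Set X} (hG : IsOpen G) :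
    ∃ χ : ℕ → X → ℝ, (∀ k, ContDiff ℝ (⊤ : ℕ∞) (χ k)) ∧ (∀ k, HasCompactSupport (χ k)) ∧
      (∀ k, tsupport (χ k) ⊆ G) ∧ (∀ k x, 0 ≤ χ k x ∧ χ k x ≤ 1) ∧
      (∀ x ∈ G, ∀ᶠ k in atTop, χ k x = 1) ∧ (∀ x ∉ G, ∀ k, χ k x = 0) := by
  obtain ⟨f, hfsupp, hfsmooth, hfrange⟩ := hG.exists_contDiff_support_eq (n := ⊤)
  have hf0 : ∀ x, 0 ≤ f x := fun x => (hfrange ⟨x, rfl⟩).1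
  let b : ℕ → ContDiffBump (0 : X) := fun k => ⟨k + 1, k + 2, by positivity, by linarith⟩
  refine ⟨fun k x => Real.smoothTransition (((k : ℝ) + 2) * f x - 1) * b k x, fun k => ?_,
    fun k => ?_, fun k => ?_, fun k x => ?_, fun x hx => ?_, fun x hx k => ?_⟩
  · exact (Real.smoothTransition.contDiff.comp
      ((contDiff_const.mul hfsmooth).sub contDiff_const)).mul (b k).contDiff
  · exact (b k).hasCompactSupport.mul_left
  · refine tsupport_mul_subset_left.trans ?_
    have hclosed : IsClosed {x : X | ((k : ℝ) + 2)⁻¹ ≤ f x} :=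
      isClosed_le continuous_const hfsmooth.continuous
    refine (closure_minimal (fun x hx => ?_) hclosed).trans fun x hx => ?_
    · rw [Function.mem_support] at hx
      have hpos : 0 < ((k : ℝ) + 2) * f x - 1 := by
        by_contra hle
        exact hx (Real.smoothTransition.zero_of_nonpos (not_lt.1 hle))
      show ((k : ℝ) + 2)⁻¹ ≤ f x
      rw [inv_le_iff_one_le_mul₀ (by positivity)]
      linarith
    · have hfx : f x ≠ 0 := by
        intro h0
        have h : ((k : ℝ) + 2)⁻¹ ≤ 0 := by simpa [h0] using hx
        exact absurd h (not_le.2 (by positivity))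
      rw [← hfsupp]
      exact Function.mem_support.2 hfx
  · exact ⟨mul_nonneg (Real.smoothTransition.nonneg _) (b k).nonneg,
      mul_le_one₀ (Real.smoothTransition.le_one _) (b k).nonneg (b k).le_one⟩
  · have hfx : 0 < f x := by
      have hne : f x ≠ 0 := by rw [← Function.mem_support, hfsupp]; exact hx
      exact lt_of_le_of_ne (hf0 x) (Ne.symm hne)
    have h1 : ∀ᶠ k : ℕ in atTop, 2 / f x ≤ (k : ℝ) + 2 :=
      eventually_atTop.2 ⟨⌈2 / f x⌉₊, fun k hk =>
        ((Nat.le_ceil _).trans (Nat.cast_le.2 hk)).trans (by linarith)⟩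
    have h2 : ∀ᶠ k : ℕ in atTop, ‖x‖ ≤ (k : ℝ) + 1 :=
      eventually_atTop.2 ⟨⌈‖x‖⌉₊, fun k hk =>
        ((Nat.le_ceil _).trans (Nat.cast_le.2 hk)).trans (by linarith)⟩
    filter_upwards [h1, h2] with k hk1 hk2
    have hsT : Real.smoothTransition (((k : ℝ) + 2) * f x - 1) = 1 := by
      apply Real.smoothTransition.one_of_one_le
      have h : 2 ≤ ((k : ℝ) + 2) * f x := by
        rw [div_le_iff₀ hfx] at hk1
        linarith
      linarith
    have hb : b k x = 1 := (b k).one_of_mem_closedBall (by simpa using hk2)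
    simp [hsT, hb]
  · have hfx : f x = 0 := by
      by_contra hne
      exact hx (hfsupp ▸ Function.mem_support.2 hne)
    simp [hfx, Real.smoothTransition.zero_of_nonpos]

/-- **Regular + invariant on generic compact supports ⇒ invariant on `⁰𝒮ₙ` (a.e. form).** Let `T` be a
degree-`n` functional that on `⁰𝒮ₙ` is integration against a FUNCTION `W` (`W·F` integrable), `L` a linear
isometry of `ℝ⁴`, and `G` an open conull set of configurations avoiding the coincidence locus such that
`T (L·F) = T F` for every compactly supported test function `F` supported in `G`. Then `T (L·F) = T F` for every
`F ∈ ⁰𝒮ₙ`. Proof: `T (L·F) - T F = ∫ (W ∘ L - W)·F` (invariance of Lebesgue measure); for `F ∈ ⁰𝒮ₙ` the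
compactly supported truncations `χ_k F` (`exists_smooth_exhaustion`) are supported in `G`, so
`∫ (W ∘ L - W)·χ_k F = 0`, and dominated convergence (`|χ_k| ≤ 1`, `χ_k → 1_G`, `Gᶜ` null) gives
`∫ (W ∘ L - W)·F = 0`. [folklore] -/
theorem apply_linActMulti_eq_of_generic (T : 𝓢((Fin n → E4), ℂ) →L[ℂ] ℂ) {W : (Fin n → E4) → ℂ}
    (hrep : ∀ F : 𝓢((Fin n → E4), ℂ), IsOffDiagonal F →
      Integrable (fun x => W x * F x) ∧ T F = ∫ x, W x * F x)
    (L : E4 ≃ₗᵢ[ℝ] E4) {G : Set (Fin n → E4)} (hGo : IsOpen G) (hG0 : volume Gᶜ = 0)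
    (hGc : G ⊆ (coincidenceLocus n E4)ᶜ)
    (hinv : ∀ F : 𝓢((Fin n → E4), ℂ), tsupport (F : (Fin n → E4) → ℂ) ⊆ G →
      HasCompactSupport (F : (Fin n → E4) → ℂ) → T (linActMulti L F) = T F)
    (F : 𝓢((Fin n → E4), ℂ)) (hF : IsOffDiagonal F) : T (linActMulti L F) = T F := by
  set ρ : (Fin n → E4) → (Fin n → E4) := fun x k => L (x k) with hρ
  -- `T (L·F') = ∫ (W ∘ ρ) F'` with an integrable integrand, for every off-diagonal `F'`
  have hint : ∀ F' : 𝓢((Fin n → E4), ℂ), IsOffDiagonal F' →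
      Integrable (fun x => W (ρ x) * F' x) ∧ T (linActMulti L F') = ∫ x, W (ρ x) * F' x := by
    intro F' hF'
    obtain ⟨h1, h2⟩ := hrep _ (isOffDiagonal_linActMulti hF' L)
    have hcomp : (fun x => W (ρ x) * F' x) = (fun y => W y * linActMulti L F' y) ∘ ρ := by
      funext x
      simp [hρ, linActMulti_apply]
    refine ⟨?_, ?_⟩
    · rw [hcomp]
      exact (measurePreserving_diag L).integrable_comp_of_integrable h1
    · rw [h2]
      exact (integral_mul_linActMulti L W F').symm
  -- the defect `D = W ∘ ρ - W` integrates to `T (L·F') - T F'` against off-diagonal `F'`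
  set D : (Fin n → E4) → ℂ := fun x => W (ρ x) - W x with hD
  have hDint : ∀ F' : 𝓢((Fin n → E4), ℂ), IsOffDiagonal F' →
      Integrable (fun x => D x * F' x) ∧ ∫ x, D x * F' x = T (linActMulti L F') - T F' := by
    intro F' hF'
    have hA := hint F' hF'
    have hB := hrep F' hF'
    have hfun : (fun x => D x * F' x) = fun x => W (ρ x) * F' x - W x * F' x := by
      funext x; simp only [hD]; ring
    rw [hfun]
    exact ⟨hA.1.sub hB.1, by rw [integral_sub hA.1 hB.1, hA.2, hB.2]⟩
  -- truncations of `F` supported in `G`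
  obtain ⟨χ, hχs, hχc, hχG, hχ01, hχ1, hχ0⟩ := exists_smooth_exhaustion hGo
  have hcs : ∀ k, HasCompactSupport fun x : Fin n → E4 => (χ k x : ℂ) * F x := fun k =>
    ((hχc k).comp_left Complex.ofReal_zero).mul_right
  have hsm : ∀ k, ContDiff ℝ (⊤ : ℕ∞) fun x : Fin n → E4 => (χ k x : ℂ) * F x := fun k =>
    (Complex.ofRealCLM.contDiff.comp (hχs k)).mul (F.smooth _)
  set Fk : ℕ → 𝓢((Fin n → E4), ℂ) := fun k => (hcs k).toSchwartzMap (hsm k) with hFk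
  have hFk_apply : ∀ k x, Fk k x = (χ k x : ℂ) * F x := fun k x => rfl
  have hFk_supp : ∀ k, tsupport (Fk k : (Fin n → E4) → ℂ) ⊆ G := fun k =>
    (tsupport_mul_subset_left (f := fun x => (χ k x : ℂ)) (g := (F : (Fin n → E4) → ℂ))).trans
      ((tsupport_comp_subset Complex.ofReal_zero (χ k)).trans (hχG k))
  have hFk_off : ∀ k, IsOffDiagonal (Fk k) := fun k =>
    IsOffDiagonal.of_tsupport_subset ((hFk_supp k).trans hGc)
  have hzero : ∀ k, ∫ x, D x * Fk k x = 0 := fun k => by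
    rw [(hDint _ (hFk_off k)).2, hinv _ (hFk_supp k) (hcs k), sub_self]
  -- dominated convergence: `∫ D·χ_k F → ∫ 1_G D·F = ∫ D·F`
  have hDF := hDint F hF
  have hlim : Tendsto (fun k => ∫ x, D x * Fk k x) atTop
      (𝓝 (∫ x, G.indicator (fun x => D x * F x) x)) := by
    refine tendsto_integral_of_dominated_convergence (fun x => ‖D x * F x‖)
      (fun k => (hDint _ (hFk_off k)).1.aestronglyMeasurable) hDF.1.norm (fun k => ?_) ?_
    · refine Eventually.of_forall fun x => ?_
      rw [hFk_apply, norm_mul, norm_mul, norm_mul, Complex.norm_real,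
        Real.norm_of_nonneg (hχ01 k x).1]
      exact mul_le_mul_of_nonneg_left (mul_le_of_le_one_left (norm_nonneg _) (hχ01 k x).2)
        (norm_nonneg _)
    · refine Eventually.of_forall fun x => ?_
      by_cases hx : x ∈ G
      · rw [Set.indicator_of_mem hx]
        refine tendsto_const_nhds.congr' ((hχ1 x hx).mono fun k hk => ?_)
        show D x * F x = D x * Fk k x
        rw [hFk_apply, hk, Complex.ofReal_one, one_mul]
      · rw [Set.indicator_of_notMem hx]
        have h : (fun k => D x * Fk k x) = fun _ => 0 := by
          funext k; rw [hFk_apply, hχ0 x hx k, Complex.ofReal_zero, zero_mul, mul_zero]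
        rw [h]
        exact tendsto_const_nhds
  have hGind : ∫ x, G.indicator (fun x => D x * F x) x = ∫ x, D x * F x :=
    integral_congr_ae (Filter.eventuallyEq_of_mem (mem_ae_iff.2 hG0)
      fun x hx => Set.indicator_of_mem hx _)
  have hDF0 : ∫ x, D x * F x = 0 := by
    rw [← hGind]
    refine tendsto_nhds_unique hlim ?_
    simp only [hzero]
    exact tendsto_const_nhds
  rw [hDF.2, sub_eq_zero] at hDF0
  exact hDF0

end Mopup

/-! ## The stub, in both strengths -/

/-- **Planar invariance from `L¹` regularity and generic invariance** — the `L¹` (function) form, i.e. the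
generation-2 registered stub `stub_mopup : ∀ S₁, NPointRegular S₁ → GenericPlanarInvariant S₁ → PlanarInvariant S₁`
of `Cruxes/NPointIsotropy/Lines/complex-rotation-bandlimit.lean` with the line-local predicates `NPointRegular`,
`GenericPlanarInvariant`, `IsPlanarGeneric`, `planarRot` unfolded verbatim. If every `𝔖ₙ|⁰𝒮` is integration
against a FUNCTION `Wₙ` (`Wₙ·F` integrable for `F ∈ ⁰𝒮ₙ`; no continuity) and `S₁` is invariant under the planar
rotations `planeRot 0 θ` on compactly supported off-diagonal test functions with planar-generic support, then `S₁` is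
planar-invariant on all of `⁰𝒮`: every determinant-one isometry fixing `e₂, e₃` is a `planeRot 0 φ`
(`Mopup.exists_eq_planeRot`), the algebraic generic set of `Mopup.exists_generic_set` is open, conull, avoids the
coincidence locus and is planar-generic at every angle, and `Mopup.apply_linActMulti_eq_of_generic` concludes.
[folklore] -/
theorem planarInvariant_of_regular (S₁ : SchwingerFamily E4)
    (hreg : ∀ n : ℕ, ∃ W : (Fin n → E4) → ℂ, ∀ F : 𝓢((Fin n → E4), ℂ), IsOffDiagonal F →
      MeasureTheory.Integrable (fun x : Fin n → E4 => W x * F x) ∧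
        S₁ n F = ∫ x : Fin n → E4, W x * F x)
    (hgen : ∀ (θ : ℝ) (n : ℕ) (F : 𝓢((Fin n → E4), ℂ)), IsOffDiagonal F →
      HasCompactSupport (F : (Fin n → E4) → ℂ) →
      (∀ x ∈ tsupport (F : (Fin n → E4) → ℂ), ∀ θ : ℝ,
        (∀ i j : Fin n, i ≠ j → (planeRot (d := 3) 0 θ (x i)) 0 ≠ (planeRot (d := 3) 0 θ (x j)) 0) ∨
        (∀ i j : Fin n, i ≠ j → (planeRot (d := 3) 0 θ (x i)) 1 ≠ (planeRot (d := 3) 0 θ (x j)) 1)) →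
      S₁ n (linActMulti (planeRot (d := 3) 0 θ) F) = S₁ n F) :
    PlanarInvariant S₁ := by
  intro R hdet h2 h3 n F hF
  obtain ⟨φ, rfl⟩ := Mopup.exists_eq_planeRot R hdet h2 h3
  obtain ⟨W, hrep⟩ := hreg n
  obtain ⟨G, hGo, hG0, hGc, hGg⟩ := Mopup.exists_generic_set n
  refine Mopup.apply_linActMulti_eq_of_generic (S₁ n) hrep _ hGo hG0 hGc (fun F' hF'G hF'c => ?_) F hF
  exact hgen φ n F' (IsOffDiagonal.of_tsupport_subset (hF'G.trans hGc)) hF'c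
    fun x hx ψ => hGg x (hF'G hx) ψ

/-- **Stub `stub_mopup` of line `complex-rotation-bandlimit` (crux `PencilRigidity.NPointIsotropy`,
stmt-QuantumFields-11686), in the text registered with the lead's generation-3 skeleton** (FUNCTION residual —
the planner's gen-2 `NPointRegular` / `GenericPlanarInvariant` unfolded over importable vocabulary): this is
`planarInvariant_of_regular`. [folklore] -/
theorem stub_mopup :
    open Literature.MathematicalPhysics.QuantumLattice Literature.MathematicalPhysics.AQFT
      Literature.MathematicalPhysics.QuantumFieldTheory
      Summit.QuantumFields.YangMills.Theorems.CurvatureBoostCovariance.Negative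
      Summit.QuantumFields.YangMills.Theorems.NPointIsotropy.Negative in
    ∀ (S₁ : SchwingerFamily E4),
      (∀ n : ℕ, ∃ W : (Fin n → E4) → ℂ, ∀ F : SchwartzMap (Fin n → E4) ℂ, IsOffDiagonal F →
        MeasureTheory.Integrable (fun x : Fin n → E4 => W x * F x) ∧
          S₁ n F = ∫ x : Fin n → E4, W x * F x) →
      (∀ (θ : ℝ) (n : ℕ) (F : SchwartzMap (Fin n → E4) ℂ), IsOffDiagonal F →
        HasCompactSupport (F : (Fin n → E4) → ℂ) →
        (∀ x ∈ tsupport (F : (Fin n → E4) → ℂ), ∀ φ : ℝ,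
          (∀ i j : Fin n, i ≠ j → (planeRot (d := 3) 0 φ (x i)) 0 ≠ (planeRot (d := 3) 0 φ (x j)) 0) ∨
          (∀ i j : Fin n, i ≠ j → (planeRot (d := 3) 0 φ (x i)) 1 ≠ (planeRot (d := 3) 0 φ (x j)) 1)) →
        S₁ n (linActMulti (planeRot (d := 3) 0 θ) F) = S₁ n F) →
      PlanarInvariant S₁ :=
  fun S₁ hreg hgen => planarInvariant_of_regular S₁ hreg hgen

/-- The same with the STRONGER residual "continuous off the coincidence locus" (verbatim the clause of the
disprover's `NPointIsotropyRegularModelBlind`, Disproof.lean §7b; the lead's r1 text): immediate by forgetting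
continuity. [folklore] -/
theorem planarInvariant_of_continuousRegular :
    open Literature.MathematicalPhysics.QuantumLattice Literature.MathematicalPhysics.AQFT
      Literature.MathematicalPhysics.QuantumFieldTheory
      Summit.QuantumFields.YangMills.Theorems.CurvatureBoostCovariance.Negative
      Summit.QuantumFields.YangMills.Theorems.NPointIsotropy.Negative in
    ∀ (S₁ : SchwingerFamily E4),
      (∀ n : ℕ, ∃ W : (Fin n → E4) → ℂ, ContinuousOn W (coincidenceLocus n E4)ᶜ ∧
        ∀ F : SchwartzMap (Fin n → E4) ℂ, IsOffDiagonal F →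
          MeasureTheory.Integrable (fun x => W x * F x) ∧ S₁ n F = ∫ x, W x * F x) →
      (∀ (θ : ℝ) (n : ℕ) (F : SchwartzMap (Fin n → E4) ℂ), IsOffDiagonal F →
        HasCompactSupport (F : (Fin n → E4) → ℂ) →
        (∀ x ∈ tsupport (F : (Fin n → E4) → ℂ), ∀ φ : ℝ,
          (∀ i j : Fin n, i ≠ j → (planeRot (d := 3) 0 φ (x i)) 0 ≠ (planeRot (d := 3) 0 φ (x j)) 0) ∨
          (∀ i j : Fin n, i ≠ j → (planeRot (d := 3) 0 φ (x i)) 1 ≠ (planeRot (d := 3) 0 φ (x j)) 1)) →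
        S₁ n (linActMulti (planeRot (d := 3) 0 θ) F) = S₁ n F) →
      PlanarInvariant S₁ := by
  intro S₁ hreg hgen
  exact planarInvariant_of_regular S₁ (fun n => (hreg n).imp fun W hW => hW.2) hgen

end Summit.QuantumFields.YangMills.Theorems.NPointIsotropy.ComplexRotationBandlimit

end
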